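import Mathlib
import HarnessLib
import Summits.Parity.GeneralizedHardyLittlewood.Theorems.ArtinGenericSplitNecessityDefs
import Literature.NumberTheory.Sieve.LinearEquationsInPrimesLocalObstruction
import Literature.NumberTheory.Sieve.LinearEquationsInPrimesDimOne
import Literature.NumberTheory.Sieve.ParityWave0

/-!
# Route `ArtinGenericSplit` — necessity package, part 1: the dilated Green–Tao system `ψᵢ(n) = aᵢ n + bᵢ`

Cell kernel by decomp-parity lens-2 g6 (HOME/decomp-parity-lens-2/g6/ArtinGenericSplit.lean @5480cd22e7b9287d), critic CLEARED
HOME/STATUS.md l.255 / CRITIC-LEDGER row 54 (precision P1: «land §5–§7 as a Theorems hand --supports stmt-Parity-26863»);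
route born rev 0 (commit 5231dbe0a256, STATUS l.300).  Landed verbatim (re-namespaced, definitions in the sibling Defs file) by
the cell's prover-class hand seat.

This file (§5a of the kernel): for the one-dimensional system `dsys a b = (aᵢ n + bᵢ)ᵢ` on the body `[0, N]`:
evaluation, non-degeneracy from injectivity + admissibility (`isNondegenerateSystem_dsys`), positivity of the
singular product (`singularProduct_dsys_pos`, via the tree's `singularProduct_pos_iff_noLocalObstruction_holds`),
`β_∞ ≥ N` (`le_archFactor_dsys`), the size bound, the dictionary `vonMangoldtSum_dsys`
(`= Σ_{m ≤ N} ∏ Λ(aᵢ m + bᵢ)`), and the Chebyshev bookkeeping `sum_not_prime_le` for prime powers.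
No new definitions (see `ArtinGenericSplitNecessityDefs`).
-/

open scoped BigOperators ArithmeticFunction.vonMangoldt Chebyshev
open Finset Filter MeasureTheory Literature.NumberTheory.Sieve

namespace Summit.Parity.GeneralizedHardyLittlewood.ArtinGenericSplitNecessity

section Dickson

variable {t : ℕ}

/-- Auxiliary step `convex_body` of the dilated-system dictionary (kernel lemma, verbatim). [folklore] -/
theorem convex_body (N : ℕ) : Convex ℝ (body N) := convex_Icc _ _

/-- Auxiliary step `body_subset_realBox` of the dilated-system dictionary (kernel lemma, verbatim). [folklore] -/
theorem body_subset_realBox (N : ℕ) : body N ⊆ realBox 1 N := by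
  refine Set.Icc_subset_Icc (fun _ => ?_) le_rfl
  simp only [Left.neg_nonpos_iff, Nat.cast_nonneg]

/-- `ψᵢ(n) = aᵢ n₀ + bᵢ`. [folklore] -/
theorem dsys_eval (a b : Fin t → ℕ) (i : Fin t) (n : Fin 1 → ℤ) :
    (dsys a b i).eval n = (a i : ℤ) * n 0 + b i := by
  rw [DimOne.eval_eq]; rfl

/-- **Non-degeneracy from admissibility** for an injective admissible family `(aᵢ n + bᵢ)ᵢ`, `aᵢ ≥ 1`
(re-proved from the tree's `LeeYangFibresPrimeCellsRelativeDickson`). [cite: GreenTao2010, Def. 1.1] -/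
theorem isNondegenerateSystem_dsys (a b : Fin t → ℕ) (ha : ∀ i, 1 ≤ a i)
    (hinj : Function.Injective fun i => (a i, b i))
    (hadm : ∀ p : ℕ, p.Prime → ∃ n : ℕ, ¬p ∣ ∏ i, (a i * n + b i)) :
    IsNondegenerateSystem (dsys a b) := by
  refine ⟨fun i h0 => ?_, fun i j hij A B hAB => ?_⟩
  · have := congr_fun h0 0
    simp only [dsys, Pi.zero_apply, Nat.cast_eq_zero] at this
    have := ha i
    omega
  · have e0 := hAB (fun _ => 0)
    have e1 := hAB (fun _ => 1)
    simp only [dsys_eval, mul_zero, zero_add, mul_one] at e0 e1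
    have h1 : A * (a i : ℤ) = B * (a j : ℤ) := by linear_combination e1 - e0
    have h2 : A * (b i : ℤ) = B * (b j : ℤ) := e0
    have hai0 : (0 : ℤ) < a i := by exact_mod_cast ha i
    have haj0 : (0 : ℤ) < a j := by exact_mod_cast ha j
    by_cases hA : A = 0
    · refine ⟨hA, ?_⟩
      rw [hA, zero_mul] at h1
      rcases mul_eq_zero.mp h1.symm with h | h
      · exact h
      · exact absurd h haj0.ne'
    by_cases hB : B = 0
    · rw [hB, zero_mul] at h1
      rcases mul_eq_zero.mp h1 with h | h
      · exact absurd h hA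
      · exact absurd h hai0.ne'
    exfalso
    have hne : (a i, b i) ≠ (a j, b j) := fun h => hij (hinj h)
    have fixed : ∀ l : Fin t, ∀ p : ℕ, p.Prime → (∀ n : ℕ, p ∣ a l * n + b l) → False := by
      intro l p hp hl
      obtain ⟨n, hn⟩ := hadm p hp
      exact hn ((hl n).trans (Finset.dvd_prod_of_mem (fun i => a i * n + b i) (Finset.mem_univ l)))
    -- local copy of the tree's `Cruxes.PrimeCellsRelative.Sketch.exists_prime_dvd_forall_of_proportional`
    -- (Theorems/LeeYangFibresPrimeCellsRelativeDicksonTools.lean, whose import closure is unbuilt on the farm snapshot)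
    have exists_prime_dvd_forall_of_proportional : ∀ {ai bi aj bj : ℕ} {A B : ℤ}, A ≠ 0 → B ≠ 0 →
        1 ≤ ai → 1 ≤ aj → (ai, bi) ≠ (aj, bj) → A * ai = B * aj → A * bi = B * bj →
        ∃ p : ℕ, p.Prime ∧ ((∀ n : ℕ, p ∣ aj * n + bj) ∨ (∀ n : ℕ, p ∣ ai * n + bi)) := by
      intro ai bi aj bj A B hA hB hai haj hne h1 h2
      have hg : 0 < Int.gcd A B := Int.gcd_pos_of_ne_zero_left _ hA
      obtain ⟨g, A', B', hg0, hcop, hAg, hBg⟩ := Int.exists_gcd_one' hg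
      have hg0' : (g : ℤ) ≠ 0 := by exact_mod_cast hg0.ne'
      have hA' : A' ≠ 0 := by rintro rfl; simp at hAg; exact hA hAg
      have hB' : B' ≠ 0 := by rintro rfl; simp at hBg; exact hB hBg
      have h1' : A' * ai = B' * aj := by
        have : A' * ai * g = B' * aj * g := by
          calc A' * ai * g = A * ai := by rw [hAg]; ring
            _ = B * aj := h1
            _ = B' * aj * g := by rw [hBg]; ring
        exact mul_right_cancel₀ hg0' this
      have h2' : A' * bi = B' * bj := by
        have : A' * bi * g = B' * bj * g := by
          calc A' * bi * g = A * bi := by rw [hAg]; ring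
            _ = B * bj := h2
            _ = B' * bj * g := by rw [hBg]; ring
        exact mul_right_cancel₀ hg0' this
      have key : ∀ {P : ℤ} {X Y : ℤ} {c d e f : ℕ}, Prime P → P ∣ X → ¬ P ∣ Y →
          X * c = Y * e → X * d = Y * f → ∀ n : ℕ, P.natAbs ∣ e * n + f := by
        intro P X Y c d e f hP hPX hPY hce hdf n
        have hid : Y * ((e * n + f : ℕ) : ℤ) = X * ((c * n + d : ℕ) : ℤ) := by
          push_cast
          linear_combination (↑n : ℤ) * hce.symm + hdf.symm
        have hdvd : P ∣ Y * ((e * n + f : ℕ) : ℤ) := hid ▸ dvd_mul_of_dvd_left hPX _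
        rcases hP.dvd_or_dvd hdvd with h | h
        · exact absurd h hPY
        · rwa [← Int.natAbs_dvd, Int.natCast_dvd_natCast] at h
      by_cases hunits : A'.natAbs = 1 ∧ B'.natAbs = 1
      · exfalso
        obtain ⟨hA1, hB1⟩ := hunits
        have hai0 : (0 : ℤ) < ai := by exact_mod_cast hai
        have haj0 : (0 : ℤ) < aj := by exact_mod_cast haj
        rcases Int.natAbs_eq_natAbs_iff.mp (hA1.trans hB1.symm) with hAB | hAB
        · rw [hAB] at h1' h2'
          have e1 : (ai : ℤ) = aj := mul_left_cancel₀ hB' h1'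
          have e2 : (bi : ℤ) = bj := mul_left_cancel₀ hB' h2'
          exact hne (by rw [Prod.mk.injEq]; exact ⟨by exact_mod_cast e1, by exact_mod_cast e2⟩)
        · rw [hAB] at h1'
          have : -B' * ai ≤ 0 ∨ 0 ≤ -B' * ai := le_total _ _
          rcases Int.natAbs_eq B' with hb | hb <;> rw [hB1] at hb <;> norm_num at hb <;>
            rw [hb] at h1' <;> push_cast at h1' <;> nlinarith
      · rw [not_and_or] at hunits
        rcases hunits with hA1 | hB1
        · obtain ⟨P, hP, hPA⟩ := Int.exists_prime_and_dvd hA1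
          have hPB : ¬ P ∣ B' := fun hPB => hP.not_unit
            (isUnit_of_dvd_one (by
              have := Int.dvd_coe_gcd hPA hPB
              rwa [hcop, Nat.cast_one] at this))
          refine ⟨P.natAbs, Int.prime_iff_natAbs_prime.mp hP, Or.inl ?_⟩
          exact key hP hPA hPB h1' h2'
        · obtain ⟨P, hP, hPB⟩ := Int.exists_prime_and_dvd hB1
          have hPA : ¬ P ∣ A' := fun hPA => hP.not_unit
            (isUnit_of_dvd_one (by
              have := Int.dvd_coe_gcd hPA hPB
              rwa [hcop, Nat.cast_one] at this))
          refine ⟨P.natAbs, Int.prime_iff_natAbs_prime.mp hP, Or.inr ?_⟩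
          exact key hP hPB hPA h1'.symm h2'.symm
    obtain ⟨p, hp, hcase⟩ := exists_prime_dvd_forall_of_proportional hA hB (ha i) (ha j) hne h1 h2
    rcases hcase with h | h
    · exact fixed j p hp h
    · exact fixed i p hp h

/-- **No local obstruction from admissibility**: `𝔖(Ψ) > 0` (re-proved from the tree's
`LeeYangFibresPrimeCellsRelativeDickson`). [cite: GreenTao2010, Lemma 1.3] -/
theorem singularProduct_dsys_pos (a b : Fin t → ℕ) (ha : ∀ i, 1 ≤ a i)
    (hinj : Function.Injective fun i => (a i, b i))
    (hadm : ∀ p : ℕ, p.Prime → ∃ n : ℕ, ¬p ∣ ∏ i, (a i * n + b i)) :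
    0 < singularProduct (dsys a b) := by
  refine singularProduct_pos_of_localFactor_pos (dsys a b) (isNondegenerateSystem_dsys a b ha hinj hadm)
    fun p hp => ?_
  haveI := Fact.mk hp
  refine (goodCount_pos_iff_localFactor_pos (dsys a b) hp).mp ?_
  obtain ⟨n, hn⟩ := hadm p hp
  refine Finset.card_pos.mpr ⟨fun _ => (n : ZMod p), ?_⟩
  rw [Finset.mem_filter]
  refine ⟨Finset.mem_univ _, fun i h0 => hn ?_⟩
  refine Dvd.dvd.trans ?_ (Finset.dvd_prod_of_mem (fun i => a i * n + b i) (Finset.mem_univ i))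
  rw [← ZMod.natCast_eq_zero_iff, ← h0]
  simp only [dsys, AffLinForm.modEval, Finset.univ_unique, Finset.sum_singleton]
  push_cast
  ring

/-- `β_∞(Ψ, [0, N]) ≥ N` (re-proved from the tree's `LeeYangFibresPrimeCellsRelativeDickson`).
[cite: GreenTao2010, (1.4)] -/
theorem le_archFactor_dsys (a b : Fin t → ℕ) (ha : ∀ i, 1 ≤ a i) (N : ℕ) :
    (N : ℝ) ≤ archFactor (dsys a b) (body N) := by
  rw [DimOne.archFactor_eq]
  set S := {r : ℝ | (fun _ : Fin 1 => r) ∈ body N ∧ ∀ i, 0 < (dsys a b i).realEval fun _ => r}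
    with hS
  have hsub : Set.Ioc (0 : ℝ) N ⊆ S := by
    intro r hr
    rw [Set.mem_Ioc] at hr
    refine ⟨⟨fun _ => hr.1.le, fun _ => hr.2⟩, fun i => ?_⟩
    rw [DimOne.realEval_eq]
    show (0 : ℝ) < (((a i : ℤ)) : ℝ) * r + ((b i : ℤ) : ℝ)
    have hai : (1 : ℝ) ≤ a i := by exact_mod_cast ha i
    have hbi : (0 : ℝ) ≤ b i := by exact_mod_cast Nat.zero_le _
    push_cast
    nlinarith
  have hsup : S ⊆ Set.Icc (0 : ℝ) N := by
    intro r hr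
    exact ⟨hr.1.1 0, hr.1.2 0⟩
  have hfin : volume S ≠ ⊤ :=
    (lt_of_le_of_lt (measure_mono hsup) (by rw [Real.volume_Icc]; exact ENNReal.ofReal_lt_top)).ne
  have h := ENNReal.toReal_mono hfin (measure_mono hsub)
  rwa [Real.volume_Ioc, sub_zero, ENNReal.toReal_ofReal (Nat.cast_nonneg N)] at h

/-- `‖Ψ‖_N ≤ ∑ᵢ (aᵢ + bᵢ)` for `N ≥ 1`. [cite: GreenTao2010, (1.1)] -/
theorem affLinSize_dsys_le (a b : Fin t → ℕ) {N : ℕ} (hN : 1 ≤ N) :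
    affLinSize (dsys a b) N ≤ ((∑ i, (a i + b i) : ℕ) : ℝ) := by
  unfold affLinSize dsys
  have hN1 : (1 : ℝ) ≤ N := by exact_mod_cast hN
  push_cast
  rw [Finset.sum_add_distrib]
  gcongr with i _ i _
  · simp
  · rw [abs_div, Nat.abs_cast, Nat.abs_cast]
    exact div_le_self (Nat.cast_nonneg _) hN1

/-- **The von Mangoldt sum of `(aᵢ n + bᵢ)ᵢ` over `[0, N]` is `∑_{m ≤ N} ∏ᵢ Λ(aᵢ m + bᵢ)`.**
[cite: GreenTao2010, (1.2)] -/
theorem vonMangoldtSum_dsys (a b : Fin t → ℕ) (N : ℕ) :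
    vonMangoldtSum (dsys a b) (body N) N = ∑ m ∈ range (N + 1), ∏ i, (Λ (a i * m + b i) : ℝ) := by
  classical
  unfold vonMangoldtSum
  have key : ∀ n : Fin 1 → ℤ, n ∈ (latticeBox 1 N).filter (fun n => realPoint n ∈ body N) →
      0 ≤ n 0 ∧ n 0 ≤ N := by
    intro n hn
    rw [Finset.mem_filter] at hn
    obtain ⟨-, hK⟩ := hn
    simp only [body, realPoint, Set.mem_Icc, Pi.le_def] at hK
    have h0 : (0 : ℝ) ≤ (n 0 : ℝ) := hK.1 0
    have h1 : ((n 0 : ℤ) : ℝ) ≤ N := hK.2 0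
    exact ⟨by exact_mod_cast h0, by exact_mod_cast h1⟩
  refine Finset.sum_nbij' (fun n => (n 0).toNat) (fun m => fun _ => (m : ℤ)) ?_ ?_ ?_ ?_ ?_
  · intro n hn
    obtain ⟨h0, h1⟩ := key n hn
    rw [Finset.mem_range]
    omega
  · intro m hm
    rw [Finset.mem_range] at hm
    rw [Finset.mem_filter]
    refine ⟨?_, ?_⟩
    · unfold latticeBox
      rw [Fintype.mem_piFinset]
      intro _
      rw [Finset.mem_Icc]
      constructor <;> omega
    · simp only [body, realPoint, Set.mem_Icc, Pi.le_def, Int.cast_natCast]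
      exact ⟨fun _ => Nat.cast_nonneg m, fun _ => by exact_mod_cast (by omega : m ≤ N)⟩
  · intro n hn
    obtain ⟨h0, -⟩ := key n hn
    funext j
    rw [Fin.fin_one_eq_zero j]
    exact Int.toNat_of_nonneg h0
  · intro m _
    simp
  · intro n hn
    obtain ⟨h0, -⟩ := key n hn
    refine Finset.prod_congr rfl fun i _ => ?_
    simp only [dsys, intVonMangoldt, DimOne.eval_eq]
    congr 1
    have : (a i : ℤ) * n 0 + b i = ((a i * (n 0).toNat + b i : ℕ) : ℤ) := by
      push_cast; rw [Int.toNat_of_nonneg h0]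
    rw [this, Int.toNat_natCast]

/-- `∑_{n ≤ X, n not prime} Λ(n) = ψ(X) − θ(X)` with the harmless `n = 0` term. [folklore] -/
theorem sum_Icc_not_prime_vonMangoldt (X : ℕ) :
    ∑ n ∈ (Finset.Icc 0 X).filter (fun n => ¬ n.Prime), (Λ n : ℝ) = ψ X - θ X := by
  classical
  rw [Chebyshev.psi_sub_theta_eq_sum_not_prime, Nat.floor_natCast]
  symm
  apply Finset.sum_subset
  · intro n hn
    rw [Finset.mem_filter, Finset.mem_Ioc] at hn
    rw [Finset.mem_filter, Finset.mem_Icc]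
    exact ⟨⟨by omega, hn.1.2⟩, hn.2⟩
  · intro n hn hn'
    rw [Finset.mem_filter, Finset.mem_Icc] at hn
    have : n = 0 := by
      by_contra h0
      exact hn' (Finset.mem_filter.mpr ⟨Finset.mem_Ioc.mpr ⟨by omega, hn.1.2⟩, hn.2⟩)
    subst this
    simp

/-- For one form `v(m) = a m + b` (`a ≥ 1`): the non-prime values contribute at most `ψ(X) − θ(X)`
to `∑_{m ≤ N}`, where `X ≥ a N + b`. [folklore] -/
theorem sum_not_prime_le (a b N X : ℕ) (ha : 1 ≤ a) (hX : a * N + b ≤ X) :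
    ∑ m ∈ (range (N + 1)).filter (fun m => ¬ (a * m + b).Prime), (Λ (a * m + b) : ℝ) ≤
      ψ X - θ X := by
  classical
  rw [← sum_Icc_not_prime_vonMangoldt]
  have hinj : Set.InjOn (fun m => a * m + b)
      ↑((range (N + 1)).filter (fun m => ¬ (a * m + b).Prime)) := by
    intro m _ m' _ h
    have : a * m + b = a * m' + b := h
    have : a * m = a * m' := by omega
    exact Nat.eq_of_mul_eq_mul_left (by omega) this
  rw [← Finset.sum_image (f := fun n => (Λ n : ℝ)) hinj]
  apply Finset.sum_le_sum_of_subset_of_nonneg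
  · intro n hn
    rw [Finset.mem_image] at hn
    obtain ⟨m, hm, rfl⟩ := hn
    rw [Finset.mem_filter, Finset.mem_range] at hm
    rw [Finset.mem_filter, Finset.mem_Icc]
    refine ⟨⟨Nat.zero_le _, le_trans ?_ hX⟩, hm.2⟩
    have : m ≤ N := by omega
    nlinarith
  · intro n _ _
    exact ArithmeticFunction.vonMangoldt_nonneg
end Dickson

end Summit.Parity.GeneralizedHardyLittlewood.ArtinGenericSplitNecessity
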